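import Literature.NumberTheory.Automorphic.RSLFactorGLOneMeasureIndependence
import Literature.NumberTheory.Automorphic.WhittakerModelsProofs
import Literature.NumberTheory.Automorphic.AdditiveCharacterDuality
import HarnessLib

/-!
# The `GL₂ × GL₁` Rankin–Selberg `L`-factor does not depend on the additive character

Topic `Literature/NumberTheory/Automorphic`; proof file (theorems only: no definition, no named
fact, no instance).  In `HasRSLFactor hmn π π' ψ ν P` ("`L(s, π × π') = 1/P(q^{-s})`", Jacquet–
Piatetski-Shapiro–Shalika 1983, Thm. 2.7 (i)–(ii)) the additive character `ψ` is a PARAMETER: the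
Whittaker functions are taken in `𝒲(π, ψ)`, `𝒲(π', ψ⁻¹)`.  For `(n, m) = (2, 1)` and `π'` the
trivial representation of `GL₁(F)` (the family `L(s, π × 1) = L(s, π)` of Jacquet–Langlands 1970,
Thm. 2.18) we prove that the predicate — for the invariant measure `ν` on `GL₁(F) ⧸ U₁` — is the
SAME for all non-trivial continuous `ψ`:

* `HasRSLFactor.mulShift`: `HasRSLFactor (1<2) π 1 ψ ν P → HasRSLFactor (1<2) π 1 (aψ) ν P` for
  `a ∈ Fˣ`, `aψ = ψ.mulShift a : x ↦ ψ(a x)`.  Proof (Jacquet–Langlands 1970, p. 36, "the factor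
  … does not depend on the choice of `ψ`"; Bushnell–Henniart 2006, §36.1 Remark; Cogdell 2004,
  §1.1): `Λ ↦ Λ ∘ π(d(a, 1))` is a bijection `Hom_U(π, ψ_U) ≅ Hom_U(π, (aψ)_U)`
  (`comp_diagonalGL_mem_whittakerFunctionals` of `WhittakerModelsProofs`) with
  `W_{Λ ∘ π(d(a,1)), v}(g) = W_{Λ, v}(d(a, 1) g)`, so that on the torus
  `Ψ(s; W_{Λ∘π(d(a,1)),v}, 1) = ∫ W_{Λ,v}(d(a h, 1)) |h|^{s-1/2} d×h = |a|^{1/2-s} Ψ(s; W_{Λ,v}, 1)`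
  (`rsZeta_comp_diagGL2_eq`): all zeta integrals are multiplied by the Laurent unit
  `|a⁻¹|^{s-1/2} = c · T^k` (`T = q^{-s}`, `c ≠ 0`, `k = -υ(a) ∈ ℤ`;
  `exists_normAbs_cpow_eq_mul_zpow`, `exists_isLaurent_evalAtQ_eq_mul_zpow`), and the fractional
  ideal `𝓘(π × 1)` — hence its normalised generator `P` — is unchanged.
* `hasRSLFactor_mulShift_iff`, and, by additive duality (every non-trivial continuous `ψ'` is
  `aψ`, `AddCharDuality.exists_eq_mulShift`; Tate 1950, Lemma 2.2.1),
  `hasRSLFactor_iff_of_isContinuousNontrivial`: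
  `HasRSLFactor (1<2) π 1 ψ₁ ν P ↔ HasRSLFactor (1<2) π 1 ψ₂ ν P` for `ψ₁`, `ψ₂` non-trivial
  continuous.

Together with `hasRSLFactor_iff_of_smulInvariant` (`RSLFactorGLOneMeasureIndependence`: no
dependence on the invariant measure) this makes the local Euler factor `L(s, π) = 1/P(q^{-s})` of
a representation of `GL₂(F)` a well-defined invariant of `π` alone, as in Jacquet–Langlands 1970,
Thm. 2.18.

## References

* H. Jacquet, R. P. Langlands, *Automorphic Forms on GL(2)*, LNM 114 (1970), Thm. 2.18 and the
  remark following it (p. 36). [JacquetLanglands1970]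
* H. Jacquet, I. I. Piatetski-Shapiro, J. A. Shalika, *Rankin–Selberg convolutions*, Amer. J.
  Math. 105 (1983), Thm. 2.7 (ii). [JacquetPiatetskiShapiroShalika1983]
* C. J. Bushnell, G. Henniart, *The local Langlands conjecture for GL(2)* (2006), §36.1 Remark,
  §1.7 Proposition. [BushnellHenniart2006]
* J. Tate, *Fourier analysis in number fields* (1950), Lemma 2.2.1. [Tate1950]
-/

noncomputable section

open scoped MatrixGroups NNReal ENNReal
open MeasureTheory ValuativeRel Polynomial Filter
  Literature.NumberTheory.GaloisRepresentations.IsNonarchimedeanLocalField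

namespace Literature.NumberTheory.Automorphic

/-! ### Part 1: Laurent monomials `c T^k`, `k ∈ ℤ`, and the scalar `|a|^{s - 1/2}` -/

section Monomial

/-- **Laurent monomials.** For `c ∈ ℂ` and `k ∈ ℤ` there is a Laurent polynomial `L ∈ ℂ(T)`
(`IsLaurent`: `Q / T^j`) whose value at `T = q^{-s}` is `c (q^{-s})^k` for EVERY `s`
(`L = c T^{k⁺} / T^{k⁻}`). [folklore] -/
theorem exists_isLaurent_evalAtQ_eq_mul_zpow {q : ℕ} (hq : 0 < q) (c : ℂ) (k : ℤ) :
    ∃ L : RatFunc ℂ, IsLaurent L ∧ ∀ s : ℂ, evalAtQ q L s = c * ((q : ℂ) ^ (-s)) ^ k := by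
  refine ⟨algebraMap ℂ[X] (RatFunc ℂ) (Polynomial.C c * X ^ k.toNat) / RatFunc.X ^ (-k).toNat,
    ⟨_, _, rfl⟩, fun s => ?_⟩
  have ht : (q : ℂ) ^ (-s) ≠ 0 := natCast_cpow_neg_ne_zero hq s
  have h := Literature.NumberTheory.EllipticCurves.Hida2000Thm326.ratFunc_eval_laurent_mul_pow
    (Polynomial.C c * X ^ k.toNat) ((-k).toNat) ht
  rw [Polynomial.eval_mul, Polynomial.eval_C, Polynomial.eval_pow, Polynomial.eval_X] at h
  have hk : ((q : ℂ) ^ (-s)) ^ k = ((q : ℂ) ^ (-s)) ^ k.toNat / ((q : ℂ) ^ (-s)) ^ (-k).toNat := by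
    rw [← zpow_natCast, ← zpow_natCast, ← zpow_sub₀ ht, Int.toNat_sub_toNat_neg]
  rw [evalAtQ, hk, mul_div_assoc', eq_div_iff (pow_ne_zero _ ht)]
  exact h

variable {F : Type*} [Field F] [ValuativeRel F] [TopologicalSpace F] [IsNonarchimedeanLocalField F]

/-- **`|a|^{s - 1/2}` is a Laurent unit in `q^{-s}`**: with `|a| = q^{-k}` (`k = υ(a)`),
`|a|^{s - 1/2} = c (q^{-s})^k` for all `s`, where `c = (q^{1/2})^k ≠ 0`. [folklore] -/
theorem exists_normAbs_cpow_eq_mul_zpow (a : Fˣ) :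
    ∃ (c : ℂ) (k : ℤ), c ≠ 0 ∧ ∀ s : ℂ,
      (((normAbs F (a : F) : ℝ≥0) : ℝ) : ℂ) ^ (s - 1 / 2) = c * (((residueFieldCard F : ℕ) : ℂ) ^ (-s)) ^ k := by
  obtain ⟨k, hk⟩ := exists_normAbs_eq_inv_zpow (F := F) a.ne_zero
  have hq0 : (0 : ℝ) < (residueFieldCard F : ℝ) := by
    exact_mod_cast Nat.pos_of_ne_zero (residueFieldCard_ne_zero F)
  have hqc : ((residueFieldCard F : ℕ) : ℂ) ≠ 0 := by
    exact_mod_cast residueFieldCard_ne_zero F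
  refine ⟨(((residueFieldCard F : ℕ) : ℂ) ^ ((1 / 2 : ℂ))) ^ k, k,
    zpow_ne_zero k (Complex.cpow_ne_zero_iff.2 (Or.inl hqc)), fun s => ?_⟩
  rw [hk, NNReal.coe_zpow, NNReal.coe_inv, NNReal.coe_natCast, ofReal_zpow_cpow (inv_pos.2 hq0) k,
    ← mul_zpow]
  congr 1
  rw [Complex.ofReal_inv, Complex.ofReal_natCast, Complex.inv_cpow _ _ (by
      rw [Complex.natCast_arg]; exact Real.pi_ne_zero.symm),
    ← Complex.cpow_neg, neg_sub, Complex.cpow_sub _ _ hqc, Complex.cpow_neg, div_eq_mul_inv]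

/-- `|a⁻¹|^w · |a|^w = 1`. [folklore] -/
theorem normAbs_inv_cpow_mul_normAbs_cpow (a : Fˣ) (w : ℂ) :
    (((normAbs F ((a⁻¹ : Fˣ) : F) : ℝ≥0) : ℝ) : ℂ) ^ w *
      (((normAbs F (a : F) : ℝ≥0) : ℝ) : ℂ) ^ w = 1 := by
  rw [← Complex.mul_cpow_ofReal_nonneg (NNReal.coe_nonneg _) (NNReal.coe_nonneg _),
    ← Complex.ofReal_mul, ← NNReal.coe_mul, ← map_mul, Units.val_inv_eq_inv_val,
    inv_mul_cancel₀ (Units.ne_zero a), map_one, NNReal.coe_one, Complex.ofReal_one, Complex.one_cpow]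

/-- `|a|^w · (|a⁻¹|^w · z) = z`. [folklore] -/
theorem normAbs_cpow_mul_normAbs_inv_cpow_mul (a : Fˣ) (w z : ℂ) :
    (((normAbs F (a : F) : ℝ≥0) : ℝ) : ℂ) ^ w *
      ((((normAbs F ((a⁻¹ : Fˣ) : F) : ℝ≥0) : ℝ) : ℂ) ^ w * z) = z := by
  rw [← mul_assoc, mul_comm (_ ^ w), normAbs_inv_cpow_mul_normAbs_cpow, one_mul]

end Monomial

/-! ### Part 2: Whittaker functionals and zeta integrals under `ψ ↦ aψ` -/

section Transport

variable {F : Type*} [Field F] [ValuativeRel F] [TopologicalSpace F] [IsNonarchimedeanLocalField F]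
  {V : Type*} [AddCommGroup V] [Module ℂ V] (π : Representation ℂ (GL (Fin 2) F) V)

omit [ValuativeRel F] [TopologicalSpace F] [IsNonarchimedeanLocalField F] in
/-- `W_{Λ ∘ π(t), v}(g) = W_{Λ, v}(t g)`. [folklore] -/
theorem whittakerModel_comp_apply (Λ : Module.Dual ℂ V) (t : GL (Fin 2) F) (v : V) (g : GL (Fin 2) F) :
    whittakerModel π (Λ ∘ₗ π t) v g = whittakerModel π Λ v (t * g) := by
  rw [whittakerModel_apply, whittakerModel_apply, LinearMap.comp_apply, map_mul, Module.End.mul_apply]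

omit [ValuativeRel F] [TopologicalSpace F] [IsNonarchimedeanLocalField F] in
/-- `d(a, b)` as a `diagonalGL`. [folklore] -/
private theorem diagGL2_eq_diagonalGL_aux (a b : Fˣ) :
    (diagGL2 a b : GL (Fin 2) F) = diagonalGL (Fin 2) F ![a, b] := by
  refine Units.ext ?_
  rw [coe_diagGL2, coe_diagonalGL]
  ext i j
  fin_cases i <;> fin_cases j <;> simp

omit [ValuativeRel F] [TopologicalSpace F] [IsNonarchimedeanLocalField F] in
/-- **Transport of Whittaker functionals along `ψ ↦ aψ`** (Bushnell–Henniart §36.1 Remark;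
`comp_diagonalGL_mem_whittakerFunctionals` with `d = (a, 1)`): if `Λ` is a `ψ`-Whittaker
functional then `Λ ∘ π(d(a, 1))` is an `aψ`-Whittaker functional (`d(a,1) n(x) d(a,1)⁻¹ = n(a x)`).
[cite: BushnellHenniart2006, §36.1 Remark] -/
theorem comp_diagGL2_mem_whittakerFunctionals {ψ : AddChar F Circle} {Λ : Module.Dual ℂ V}
    (hΛ : Λ ∈ whittakerFunctionals π ψ) (a : Fˣ) :
    Λ ∘ₗ π (diagGL2 a 1) ∈ whittakerFunctionals π (ψ.mulShift (a : F)) := by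
  rw [diagGL2_eq_diagonalGL_aux]
  refine comp_diagonalGL_mem_whittakerFunctionals π ψ hΛ ![a, 1] a fun i j hij => ?_
  fin_cases i <;> fin_cases j <;> simp at hij ⊢

omit [ValuativeRel F] [TopologicalSpace F] [IsNonarchimedeanLocalField F] in
/-- The inverse transport: if `M` is an `aψ`-Whittaker functional then `M ∘ π(d(a⁻¹, 1))` is a
`ψ`-Whittaker functional, and `M = (M ∘ π(d(a⁻¹, 1))) ∘ π(d(a, 1))`. [folklore] -/
theorem comp_diagGL2_inv_mem_whittakerFunctionals {ψ : AddChar F Circle} {M : Module.Dual ℂ V}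
    (a : Fˣ) (hM : M ∈ whittakerFunctionals π (ψ.mulShift (a : F))) :
    M ∘ₗ π (diagGL2 a⁻¹ 1) ∈ whittakerFunctionals π ψ ∧
      (M ∘ₗ π (diagGL2 a⁻¹ 1)) ∘ₗ π (diagGL2 a 1) = M := by
  constructor
  · have h := comp_diagGL2_mem_whittakerFunctionals π hM a⁻¹
    rwa [AddChar.mulShift_mulShift, Units.val_inv_eq_inv_val, mul_inv_cancel₀ (Units.ne_zero a),
      AddChar.mulShift_one] at h
  · rw [LinearMap.comp_assoc, ← Module.End.mul_eq_comp, ← map_mul, ← diagGL2_mul, inv_mul_cancel,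
      mul_one, diagGL2_one, map_one, Module.End.one_eq_id, LinearMap.comp_id]

variable [MeasurableSpace F] [BorelSpace F]

/-- **Dilating the torus variable**: for a left-invariant `μ'` on `Fˣ`,
`∫ W_{Λ,v}(d(a h, 1)) κ |h|^c dμ'(h) = |a⁻¹|^c ∫ W_{Λ,v}(d(h, 1)) κ |h|^c dμ'(h)` (`h ↦ a⁻¹ h`).
[folklore] -/
theorem integral_whittakerModel_diagGL2_mul_left (μ' : Measure Fˣ) [μ'.IsMulLeftInvariant]
    (Λ : Module.Dual ℂ V) (v : V) (a : Fˣ) (κ c : ℂ) :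
    (∫ h, whittakerModel π Λ v (diagGL2 (a * h) 1) * κ *
        (((normAbs F (h : F) : ℝ≥0) : ℝ) : ℂ) ^ c ∂μ') =
      (((normAbs F ((a⁻¹ : Fˣ) : F) : ℝ≥0) : ℝ) : ℂ) ^ c *
        ∫ h, whittakerModel π Λ v (diagGL2 h 1) * κ * (((normAbs F (h : F) : ℝ≥0) : ℝ) : ℂ) ^ c ∂μ' := by
  haveI : T2Space F :=
    (Literature.NumberTheory.GaloisRepresentations.IsNonarchimedeanLocalField.isLocalField F).toT2Space
  haveI : BorelSpace Fˣ := Units.borelSpace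
  have key := integral_mul_left_eq_self (μ := μ') (fun h : Fˣ => whittakerModel π Λ v (diagGL2 h 1) * κ *
    (((normAbs F (((a⁻¹ * h : Fˣ)) : F) : ℝ≥0) : ℝ) : ℂ) ^ c) a
  simp only [inv_mul_cancel_left] at key
  rw [key, ← integral_const_mul]
  refine integral_congr_ae (Eventually.of_forall fun h => ?_)
  simp only
  rw [Units.val_mul, map_mul, NNReal.coe_mul, Complex.ofReal_mul,
    Complex.mul_cpow_ofReal_nonneg (NNReal.coe_nonneg _) (NNReal.coe_nonneg _)]
  ring

variable [MeasurableSpace (GL (Fin 1) F ⧸ upperUnitriangular (Fin 1) F)]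

/-- **The zeta integral of a transported Whittaker function** (Jacquet–Langlands 1970, p. 36;
JPSS 1983, (2.7)): for the invariant measure `ν` on `GL₁(F) ⧸ U₁` (transport of a Haar measure
`μ'` of `Fˣ`) and a constant `W'` (Whittaker function of the trivial representation of `GL₁(F)`),
`Ψ(s; W_{Λ ∘ π(d(a,1)), v}, W') = |a⁻¹|^{s - 1/2} Ψ(s; W_{Λ, v}, W')`.
[cite: JacquetLanglands1970, Thm. 2.18 and p. 36] -/
theorem rsZeta_comp_diagGL2_eq (μ' : Measure Fˣ) [μ'.IsHaarMeasure]
    (ν : Measure (GL (Fin 1) F ⧸ upperUnitriangular (Fin 1) F))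
    (hint : ∀ f : GL (Fin 1) F ⧸ upperUnitriangular (Fin 1) F → ℂ,
      ∫ x, f x ∂ν = ∫ a : Fˣ, f (QuotientGroup.mk (glDiagonal 1 F fun _ => a)) ∂μ')
    (Λ : Module.Dual ℂ V) (v : V) (a : Fˣ) (Λ' : Module.Dual ℂ ℂ) (v' : ℂ) (s : ℂ) :
    rsZeta Nat.one_lt_two ν (whittakerModel π (Λ ∘ₗ π (diagGL2 a 1)) v)
        (whittakerModel (Representation.trivial ℂ (GL (Fin 1) F) ℂ) Λ' v') s =
      (((normAbs F ((a⁻¹ : Fˣ) : F) : ℝ≥0) : ℝ) : ℂ) ^ (s - 1 / 2) *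
        rsZeta Nat.one_lt_two ν (whittakerModel π Λ v)
          (whittakerModel (Representation.trivial ℂ (GL (Fin 1) F) ℂ) Λ' v') s := by
  have hW' : ∀ g, whittakerModel (Representation.trivial ℂ (GL (Fin 1) F) ℂ) Λ' v' g = Λ' v' :=
    fun g => whittakerModel_trivial_apply _ _ g
  rw [rsZeta_eq_integral_torus μ' ν hint _ hW' s, rsZeta_eq_integral_torus μ' ν hint _ hW' s]
  simp_rw [whittakerModel_comp_apply, ← diagGL2_mul, mul_one]
  exact integral_whittakerModel_diagGL2_mul_left π μ' Λ v a (Λ' v') (s - 1 / 2)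

end Transport

/-! ### Part 3: `HasRSLFactor` under `ψ ↦ aψ` and under an arbitrary change of `ψ` -/

section Independence

variable {F : Type*} [Field F] [ValuativeRel F] [TopologicalSpace F] [IsNonarchimedeanLocalField F]
  [MeasurableSpace F] [BorelSpace F]
  [MeasurableSpace (GL (Fin 1) F ⧸ upperUnitriangular (Fin 1) F)]
  [BorelSpace (GL (Fin 1) F ⧸ upperUnitriangular (Fin 1) F)]
  {V : Type*} [AddCommGroup V] [Module ℂ V] (π : Representation ℂ (GL (Fin 2) F) V)

/-- **`L(s, π × 1)` does not depend on `ψ`: dilations** (Jacquet–Langlands 1970, Thm. 2.18 and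
p. 36; JPSS 1983, Thm. 2.7 (ii); Bushnell–Henniart 2006, §36.1 Remark).  For the invariant measure
`ν` on `GL₁(F) ⧸ U₁` and `a ∈ Fˣ`: `HasRSLFactor (1<2) π 1 ψ ν P → HasRSLFactor (1<2) π 1 (aψ) ν P`.
Every zeta integral for `aψ` is `|a⁻¹|^{s-1/2} = c T^k` (`T = q^{-s}`, `c ≠ 0`, `k ∈ ℤ`) times a
zeta integral for `ψ` (`rsZeta_comp_diagGL2_eq`), so clause (a) keeps its denominator `P` and the
combination of clause (b) representing `P⁻¹` is transported with the coefficients `Q_i |a|^{s-1/2}`.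
[cite: JacquetLanglands1970, Thm. 2.18] [cite: JacquetPiatetskiShapiroShalika1983, Thm. 2.7 (ii)] -/
theorem HasRSLFactor.mulShift {ψ : AddChar F Circle}
    {ν : Measure (GL (Fin 1) F ⧸ upperUnitriangular (Fin 1) F)}
    [SMulInvariantMeasure (GL (Fin 1) F) (GL (Fin 1) F ⧸ upperUnitriangular (Fin 1) F) ν]
    [IsFiniteMeasureOnCompacts ν] [ν.IsOpenPosMeasure] {P : ℂ[X]}
    (hP : HasRSLFactor Nat.one_lt_two π (Representation.trivial ℂ (GL (Fin 1) F) ℂ) ψ ν P)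
    (a : Fˣ) :
    HasRSLFactor Nat.one_lt_two π (Representation.trivial ℂ (GL (Fin 1) F) ℂ)
      (ψ.mulShift (a : F)) ν P := by
  haveI : T2Space F :=
    (Literature.NumberTheory.GaloisRepresentations.IsNonarchimedeanLocalField.isLocalField F).toT2Space
  haveI : BorelSpace Fˣ := Units.borelSpace
  set q : ℕ := residueFieldCard F with hq_def
  have hq : 1 < q := one_lt_residueFieldCard F
  have hq0 : 0 < q := zero_lt_one.trans hq
  obtain ⟨μ', hμ', hint⟩ := exists_isHaarMeasure_integral_eq ν
  haveI := hμ'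
  -- the two Laurent units `|a⁻¹|^{s-1/2} = L⁺(q^{-s})`, `|a|^{s-1/2} = L⁻(q^{-s})`
  obtain ⟨c₁, k₁, -, hc₁⟩ := exists_normAbs_cpow_eq_mul_zpow (F := F) a⁻¹
  obtain ⟨c₂, k₂, -, hc₂⟩ := exists_normAbs_cpow_eq_mul_zpow (F := F) a
  obtain ⟨L₁, hL₁, hL₁e⟩ := exists_isLaurent_evalAtQ_eq_mul_zpow hq0 c₁ k₁
  obtain ⟨L₂, hL₂, hL₂e⟩ := exists_isLaurent_evalAtQ_eq_mul_zpow hq0 c₂ k₂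
  have hL₁v : ∀ s, evalAtQ q L₁ s = (((normAbs F ((a⁻¹ : Fˣ) : F) : ℝ≥0) : ℝ) : ℂ) ^ (s - 1 / 2) :=
    fun s => by rw [hL₁e, hc₁]
  have hL₂v : ∀ s, evalAtQ q L₂ s = (((normAbs F (a : F) : ℝ≥0) : ℝ) : ℂ) ^ (s - 1 / 2) :=
    fun s => by rw [hL₂e, hc₂]
  -- the Whittaker functionals of the trivial representation of `GL₁(F)` are all functionals
  have htop : ∀ (θ : AddChar F Circle) (Λ' : Module.Dual ℂ ℂ),
      Λ' ∈ whittakerFunctionals (Representation.trivial ℂ (GL (Fin 1) F) ℂ) θ := fun θ Λ' => by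
    rw [whittakerFunctionals_eq_top_of_fin_one]
    trivial
  obtain ⟨h0, ha, k, Λ, Λ', v, v', Q, hΛ, hΛ', hQ, hE⟩ := hP
  refine ⟨h0, fun M hM L' _ w w' => ?_, k, fun i => Λ i ∘ₗ π (diagGL2 a 1), Λ', v, v',
    fun i => Q i * L₂, fun i => comp_diagGL2_mem_whittakerFunctionals π (hΛ i) a,
    fun i => htop _ _, fun i => (hQ i).mul hL₂, ?_⟩
  · -- clause (a): `M = Λ ∘ π(d(a,1))` with `Λ` a `ψ`-functional
    obtain ⟨hΛM, hM'⟩ := comp_diagGL2_inv_mem_whittakerFunctionals π a hM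
    obtain ⟨R, hR, hRE⟩ := ha _ hΛM L' (htop _ _) w w'
    refine ⟨L₁ * R, hL₁.mul hR, ?_⟩
    rw [← hM']
    rw [eqOnRightHalfPlane_iff] at hRE ⊢
    filter_upwards [hRE, eventually_evalAtQ_mul hq L₁ (R * rsLRat P)] with s hs hmul
    rw [rsZeta_comp_diagGL2_eq π μ' ν hint, hs, mul_assoc, hmul, hL₁v]
  · -- clause (b): transport the combination representing `P⁻¹`
    rw [eqOnRightHalfPlane_iff] at hE ⊢
    have hQL : ∀ᶠ s in rightHalfPlanes, ∀ i, evalAtQ q (Q i * L₂) s = evalAtQ q (Q i) s * evalAtQ q L₂ s :=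
      Filter.eventually_all.2 fun i => eventually_evalAtQ_mul hq (Q i) L₂
    filter_upwards [hE, hQL] with s hs hQs
    rw [← hs]
    refine Finset.sum_congr rfl fun i _ => ?_
    rw [hQs i, rsZeta_comp_diagGL2_eq π μ' ν hint, hL₂v, mul_assoc,
      normAbs_cpow_mul_normAbs_inv_cpow_mul]

/-- **`L(s, π × 1)` does not depend on `ψ`: `aψ` versus `ψ`.**
[cite: JacquetLanglands1970, Thm. 2.18] [cite: JacquetPiatetskiShapiroShalika1983, Thm. 2.7 (ii)] -/
theorem hasRSLFactor_mulShift_iff {ψ : AddChar F Circle}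
    (ν : Measure (GL (Fin 1) F ⧸ upperUnitriangular (Fin 1) F))
    [SMulInvariantMeasure (GL (Fin 1) F) (GL (Fin 1) F ⧸ upperUnitriangular (Fin 1) F) ν]
    [IsFiniteMeasureOnCompacts ν] [ν.IsOpenPosMeasure] (a : Fˣ) (P : ℂ[X]) :
    HasRSLFactor Nat.one_lt_two π (Representation.trivial ℂ (GL (Fin 1) F) ℂ)
        (ψ.mulShift (a : F)) ν P ↔
      HasRSLFactor Nat.one_lt_two π (Representation.trivial ℂ (GL (Fin 1) F) ℂ) ψ ν P := by
  refine ⟨fun h => ?_, fun h => h.mulShift π a⟩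
  have h' := h.mulShift π a⁻¹
  rwa [AddChar.mulShift_mulShift, Units.val_inv_eq_inv_val, mul_inv_cancel₀ (Units.ne_zero a),
    AddChar.mulShift_one] at h'

/-- **The `GL₂ × GL₁` Rankin–Selberg `L`-factor `L(s, π × 1) = L(s, π)` does not depend on the
non-trivial continuous additive character** (Jacquet–Langlands 1970, Thm. 2.18 and p. 36; JPSS
1983, Thm. 2.7 (ii)): by additive duality `ψ₂ = aψ₁` for some `a ∈ Fˣ`
(`AddCharDuality.exists_eq_mulShift`; Tate 1950, Lemma 2.2.1), and `hasRSLFactor_mulShift_iff`.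
[cite: JacquetLanglands1970, Thm. 2.18] [cite: Tate1950, Lemma 2.2.1] -/
theorem hasRSLFactor_iff_of_isContinuousNontrivial {ψ₁ ψ₂ : AddChar F Circle}
    (hψ₁ : ψ₁.IsContinuousNontrivial) (hψ₂ : ψ₂.IsContinuousNontrivial)
    (ν : Measure (GL (Fin 1) F ⧸ upperUnitriangular (Fin 1) F))
    [SMulInvariantMeasure (GL (Fin 1) F) (GL (Fin 1) F ⧸ upperUnitriangular (Fin 1) F) ν]
    [IsFiniteMeasureOnCompacts ν] [ν.IsOpenPosMeasure] (P : ℂ[X]) :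
    HasRSLFactor Nat.one_lt_two π (Representation.trivial ℂ (GL (Fin 1) F) ℂ) ψ₁ ν P ↔
      HasRSLFactor Nat.one_lt_two π (Representation.trivial ℂ (GL (Fin 1) F) ℂ) ψ₂ ν P := by
  obtain ⟨a, rfl⟩ := AddCharDuality.exists_eq_mulShift hψ₁ hψ₂.1
  have ha : a ≠ 0 := by
    rintro rfl
    obtain ⟨x, hx⟩ := AddChar.ne_zero_iff.1 hψ₂.2
    exact hx (by rw [AddChar.mulShift_zero, AddChar.one_apply])
  have key := hasRSLFactor_mulShift_iff π (ψ := ψ₁) ν (Units.mk0 a ha) P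
  rw [Units.val_mk0] at key
  exact key.symm

end Independence

end Literature.NumberTheory.Automorphic

end
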